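import Mathlib
import HarnessLib
import Literature.Probability.Distributions.GaussianMoments

/-!
# Crux `FemtoCurvatureTwoPoint` (stmt-QuantumFields-9363, route `LangevinControlUV`):
# stub W — Wick / Isserlis covariance of squares for `multivariateGaussian`

Helper for the line `generic-step-gamma-encoding` (`--supports stmt-QuantumFields-9363`), closing
the registered stub `stub_wickSquares` verbatim: for a centred Gaussian vector `a ~ N(0, S)` on a
finite index type `ι` (Mathlib's `ProbabilityTheory.multivariateGaussian 0 S`, `S` positive
semidefinite) and two linear functionals `X = ∑ uᵢ aᵢ`, `Y = ∑ vᵢ aᵢ`,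

  `E[X² Y²] − E[X²] E[Y²] = 2 (uᵀ S v)²`  (`= 2 Cov(X, Y)²`),

the order-four case of the Isserlis (1918) / Wick (1950) formula. It is the pure-probability input
of the leading term of the fixed-torus `β → ∞` asymptotics of plaquette–plaquette covariances
(consumed by the lead's glue `axisGaussianLower_of_domination` with `ι` = edges of the torus).

Proof (polarisation, no multivariate moment combinatorics): every linear functional
`x ↦ ∑ wᵢ xᵢ` of `multivariateGaussian 0 S` has law `gaussianReal 0 (wᵀ S w)`
(`IsGaussian.map_eq_gaussianReal`, `covarianceBilin_multivariateGaussian`), so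
`E[(∑ wᵢ aᵢ)²] = wᵀ S w` and `E[(∑ wᵢ aᵢ)⁴] = 3 (wᵀ S w)²` (one-dimensional moments, tree file
`Literature.Probability.Distributions.GaussianMoments`); then
`12 X² Y² = (X+Y)⁴ + (X−Y)⁴ − 2X⁴ − 2Y⁴` and `(u ± v)ᵀ S (u ± v) = uᵀSu ± 2 uᵀSv + vᵀSv`.

Not here: the general Isserlis pairing formula (order four in an orthonormal frame is
`Literature.Probability.Distributions.integral_coord_four_stdGaussian`).
-/

noncomputable section

open scoped BigOperators Matrix
open MeasureTheory ProbabilityTheory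

namespace Summit.QuantumFields.YangMills.Theorems.FemtoCurvatureTwoPoint.WickSquares

section LinearFunctionals

variable {ι : Type} [Fintype ι] {S : Matrix ι ι ℝ}

/-- A real positive semidefinite matrix has a symmetric bilinear form `a ⬝ᵥ S *ᵥ b`. [folklore] -/
theorem dotProduct_mulVec_comm_of_posSemidef (hS : S.PosSemidef) (a b : ι → ℝ) :
    a ⬝ᵥ S *ᵥ b = b ⬝ᵥ S *ᵥ a := by
  have hT : Sᵀ = S := by
    have h := hS.1
    rw [Matrix.IsHermitian, Matrix.conjTranspose_eq_transpose_of_trivial] at h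
    exact h
  calc a ⬝ᵥ S *ᵥ b = (a ᵥ* S) ⬝ᵥ b := Matrix.dotProduct_mulVec a S b
    _ = (Sᵀ *ᵥ a) ⬝ᵥ b := by rw [Matrix.mulVec_transpose]
    _ = b ⬝ᵥ S *ᵥ a := by rw [hT, dotProduct_comm]

/-- The quadratic form of a real positive semidefinite matrix is non-negative. [folklore] -/
theorem dotProduct_mulVec_self_nonneg (hS : S.PosSemidef) (w : ι → ℝ) : 0 ≤ w ⬝ᵥ S *ᵥ w := by
  have h := hS.dotProduct_mulVec_nonneg w
  rwa [star_trivial] at h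

/-- Polarisation of the quadratic form: `(u+v)ᵀS(u+v) = uᵀSu + 2uᵀSv + vᵀSv`. [folklore] -/
theorem dotProduct_mulVec_add_add (hS : S.PosSemidef) (u v : ι → ℝ) :
    (u + v) ⬝ᵥ S *ᵥ (u + v) = u ⬝ᵥ S *ᵥ u + 2 * (u ⬝ᵥ S *ᵥ v) + v ⬝ᵥ S *ᵥ v := by
  rw [Matrix.mulVec_add, add_dotProduct, dotProduct_add, dotProduct_add,
    dotProduct_mulVec_comm_of_posSemidef hS v u]
  ring

/-- Polarisation of the quadratic form: `(u−v)ᵀS(u−v) = uᵀSu − 2uᵀSv + vᵀSv`. [folklore] -/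
theorem dotProduct_mulVec_sub_sub (hS : S.PosSemidef) (u v : ι → ℝ) :
    (u - v) ⬝ᵥ S *ᵥ (u - v) = u ⬝ᵥ S *ᵥ u - 2 * (u ⬝ᵥ S *ᵥ v) + v ⬝ᵥ S *ᵥ v := by
  rw [Matrix.mulVec_sub, sub_dotProduct, dotProduct_sub, dotProduct_sub,
    dotProduct_mulVec_comm_of_posSemidef hS v u]
  ring

/-- The coordinate functional `x ↦ ∑ wᵢ xᵢ` on `EuclideanSpace ℝ ι` is the inner product with the
vector of coordinates `w`. [folklore] -/
theorem sum_mul_coord_eq_innerSL (w : ι → ℝ) :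
    (fun x : EuclideanSpace ℝ ι => ∑ i, w i * x i) =
      ⇑(innerSL ℝ (WithLp.toLp 2 w : EuclideanSpace ℝ ι)) := by
  funext x
  simp only [coe_innerSL_apply, PiLp.inner_apply, RCLike.inner_apply, conj_trivial]
  exact Finset.sum_congr rfl fun i _ => mul_comm _ _

variable [DecidableEq ι]

/-- **Law of a linear functional of a centred multivariate Gaussian**: under
`multivariateGaussian 0 S` (`S` positive semidefinite) the functional `x ↦ ∑ wᵢ xᵢ` has law
`N(0, wᵀ S w)`. [folklore] -/
theorem map_sum_mul_multivariateGaussian (hS : S.PosSemidef) (w : ι → ℝ) :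
    (multivariateGaussian 0 S).map (fun x : EuclideanSpace ℝ ι => ∑ i, w i * x i) =
      gaussianReal 0 (w ⬝ᵥ S *ᵥ w).toNNReal := by
  set L : StrongDual ℝ (EuclideanSpace ℝ ι) := innerSL ℝ (WithLp.toLp 2 w : EuclideanSpace ℝ ι)
    with hL
  rw [sum_mul_coord_eq_innerSL w, IsGaussian.map_eq_gaussianReal L]
  have hmean : (multivariateGaussian 0 S)[L] = 0 := by
    rw [IsGaussian.integral_dual L, integral_id_multivariateGaussian, map_zero]
  have hvar : Var[L; multivariateGaussian 0 S] = w ⬝ᵥ S *ᵥ w := by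
    rw [hL, coe_innerSL_apply, ← covarianceBilin_self IsGaussian.memLp_two_id,
      covarianceBilin_multivariateGaussian hS]
  rw [hmean, hvar]

/-- Moments of a linear functional of `multivariateGaussian 0 S` are the moments of
`N(0, wᵀ S w)`. [folklore] -/
theorem integral_sum_mul_pow_multivariateGaussian (hS : S.PosSemidef) (w : ι → ℝ) (n : ℕ) :
    ∫ x, (∑ i, w i * x i) ^ n ∂(multivariateGaussian 0 S) =
      ∫ y, y ^ n ∂(gaussianReal 0 (w ⬝ᵥ S *ᵥ w).toNNReal) := by
  rw [← map_sum_mul_multivariateGaussian hS w, integral_map (by fun_prop) (by fun_prop)]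

/-- Powers of a linear functional of `multivariateGaussian 0 S` are integrable. [folklore] -/
theorem integrable_sum_mul_pow_multivariateGaussian (hS : S.PosSemidef) (w : ι → ℝ) (n : ℕ) :
    Integrable (fun x : EuclideanSpace ℝ ι => (∑ i, w i * x i) ^ n) (multivariateGaussian 0 S) := by
  have h1 : Integrable (fun y : ℝ => y ^ n)
      ((multivariateGaussian 0 S).map (fun x : EuclideanSpace ℝ ι => ∑ i, w i * x i)) := by
    rw [map_sum_mul_multivariateGaussian hS w]
    exact Literature.Probability.Distributions.integrable_pow_gaussianReal 0 _ n
  exact h1.comp_measurable (by fun_prop)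

/-- **Second moment**: `E[(∑ wᵢ aᵢ)²] = wᵀ S w` for `a ~ N(0, S)`. [folklore] -/
theorem integral_sum_mul_sq_multivariateGaussian (hS : S.PosSemidef) (w : ι → ℝ) :
    ∫ x, (∑ i, w i * x i) ^ 2 ∂(multivariateGaussian 0 S) = w ⬝ᵥ S *ᵥ w := by
  rw [integral_sum_mul_pow_multivariateGaussian hS w 2]
  have h := Literature.Probability.Distributions.integral_pow_even_gaussianReal
    (w ⬝ᵥ S *ᵥ w).toNNReal 1
  rw [show 2 * 1 = 2 from rfl] at h
  rw [h, Real.coe_toNNReal _ (dotProduct_mulVec_self_nonneg hS w)]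
  norm_num [Nat.doubleFactorial]

/-- **Fourth moment**: `E[(∑ wᵢ aᵢ)⁴] = 3 (wᵀ S w)²` for `a ~ N(0, S)` (Isserlis 1918 / Wick 1950,
one-dimensional case `E ξ⁴ = 3σ⁴`). [folklore] -/
theorem integral_sum_mul_pow_four_multivariateGaussian (hS : S.PosSemidef) (w : ι → ℝ) :
    ∫ x, (∑ i, w i * x i) ^ 4 ∂(multivariateGaussian 0 S) = 3 * (w ⬝ᵥ S *ᵥ w) ^ 2 := by
  rw [integral_sum_mul_pow_multivariateGaussian hS w 4]
  have h := Literature.Probability.Distributions.integral_pow_even_gaussianReal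
    (w ⬝ᵥ S *ᵥ w).toNNReal 2
  rw [show 2 * 2 = 4 from rfl] at h
  rw [h, Real.coe_toNNReal _ (dotProduct_mulVec_self_nonneg hS w)]
  norm_num [Nat.doubleFactorial]
  ring

end LinearFunctionals

end Summit.QuantumFields.YangMills.Theorems.FemtoCurvatureTwoPoint.WickSquares

namespace Summit.QuantumFields.YangMills.Theorems.FemtoCurvatureTwoPoint

open WickSquares in
/-- **Stub W — Wick / Isserlis covariance of squares** (line `generic-step-gamma-encoding` of crux
`FemtoCurvatureTwoPoint`, registered signature verbatim). For a centred Gaussian vector `a` on a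
finite index type `ι` with positive semidefinite covariance matrix `S`
(`multivariateGaussian 0 S`) and `X = ∑ uᵢ aᵢ`, `Y = ∑ vᵢ aᵢ`:
`E[X² Y²] − E[X²] E[Y²] = 2 (uᵀ S v)²` (Isserlis 1918; Wick 1950). Proof by polarisation
`12 X²Y² = (X+Y)⁴ + (X−Y)⁴ − 2X⁴ − 2Y⁴` and the Gaussian moments `E ξ² = σ²`, `E ξ⁴ = 3σ⁴`.
[folklore] -/
theorem stub_wickSquares :
    ∀ (ι : Type) [Fintype ι] [DecidableEq ι] (S : Matrix ι ι ℝ), S.PosSemidef →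
    ∀ (u v : ι → ℝ),
      (∫ x, (∑ i, u i * x i) ^ 2 * (∑ i, v i * x i) ^ 2 ∂(multivariateGaussian 0 S))
        - (∫ x, (∑ i, u i * x i) ^ 2 ∂(multivariateGaussian 0 S))
          * (∫ x, (∑ i, v i * x i) ^ 2 ∂(multivariateGaussian 0 S))
      = 2 * (u ⬝ᵥ S *ᵥ v) ^ 2 := by
  intro ι _ _ S hS u v
  -- polarisation, pointwise
  have hpt : (fun x : EuclideanSpace ℝ ι => (∑ i, u i * x i) ^ 2 * (∑ i, v i * x i) ^ 2) =
      fun x : EuclideanSpace ℝ ι => ((∑ i, (u + v) i * x i) ^ 4 + (∑ i, (u - v) i * x i) ^ 4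
        - 2 * (∑ i, u i * x i) ^ 4 - 2 * (∑ i, v i * x i) ^ 4) / 12 := by
    funext x
    have h1 : ∑ i, (u + v) i * x i = (∑ i, u i * x i) + ∑ i, v i * x i := by
      simp only [Pi.add_apply, add_mul, Finset.sum_add_distrib]
    have h2 : ∑ i, (u - v) i * x i = (∑ i, u i * x i) - ∑ i, v i * x i := by
      simp only [Pi.sub_apply, sub_mul, Finset.sum_sub_distrib]
    rw [h1, h2]
    ring
  have i1 := integrable_sum_mul_pow_multivariateGaussian hS (u + v) 4
  have i2 := integrable_sum_mul_pow_multivariateGaussian hS (u - v) 4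
  have i3 := (integrable_sum_mul_pow_multivariateGaussian hS u 4).const_mul 2
  have i4 := (integrable_sum_mul_pow_multivariateGaussian hS v 4).const_mul 2
  have i12 : Integrable (fun x : EuclideanSpace ℝ ι =>
      (∑ i, (u + v) i * x i) ^ 4 + (∑ i, (u - v) i * x i) ^ 4) (multivariateGaussian 0 S) :=
    i1.add i2
  have i123 : Integrable (fun x : EuclideanSpace ℝ ι =>
      (∑ i, (u + v) i * x i) ^ 4 + (∑ i, (u - v) i * x i) ^ 4 - 2 * (∑ i, u i * x i) ^ 4)
      (multivariateGaussian 0 S) :=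
    i12.sub i3
  have hI : ∫ x, (∑ i, u i * x i) ^ 2 * (∑ i, v i * x i) ^ 2 ∂(multivariateGaussian 0 S) =
      (3 * ((u + v) ⬝ᵥ S *ᵥ (u + v)) ^ 2 + 3 * ((u - v) ⬝ᵥ S *ᵥ (u - v)) ^ 2
        - 2 * (3 * (u ⬝ᵥ S *ᵥ u) ^ 2) - 2 * (3 * (v ⬝ᵥ S *ᵥ v) ^ 2)) / 12 := by
    rw [hpt, integral_div, integral_sub i123 i4, integral_sub i12 i3,
      integral_add i1 i2, integral_const_mul, integral_const_mul,
      integral_sum_mul_pow_four_multivariateGaussian hS (u + v),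
      integral_sum_mul_pow_four_multivariateGaussian hS (u - v),
      integral_sum_mul_pow_four_multivariateGaussian hS u,
      integral_sum_mul_pow_four_multivariateGaussian hS v]
  rw [hI, integral_sum_mul_sq_multivariateGaussian hS u, integral_sum_mul_sq_multivariateGaussian hS v,
    dotProduct_mulVec_add_add hS, dotProduct_mulVec_sub_sub hS]
  ring

end Summit.QuantumFields.YangMills.Theorems.FemtoCurvatureTwoPoint

end
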